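import Mathlib
import HarnessLib
import HarnessLib.Audit
import Summits.CriticalPhenomena.Statement
import Literature.Probability.RandomPlanarGeometry.ChordalCurveFamily
import Literature.Probability.RandomPlanarGeometry.SLEConvergenceCriterion
import Literature.Probability.RandomPlanarGeometry.ConformalRestriction
import HarnessLib.Audit.Status.Attr

/-!
Route: SAWConfRestriction

It suffices to show X1 [conformal restriction limit]: there is a chordal curve family P (D ↦
probability law on
curves modulo reparametrisation, carried by curves in D̄ from a to b) such that
 (lim)  for every Dobrushin domain (Ω; a, b) and EVERY endpoint approximation
(Literature.Probability.RandomPlanarGeometry.SAW.IsEndpointApprox) the critical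
        square-lattice SAW law Literature.Probability.RandomPlanarGeometry.SAW.law, pushed to
CurveClass ℂ, converges weakly (Literature.Probability.RandomPlanarGeometry.TendstoLaw, target r.v.
= id) to P D;
 (conf) P is conformally covariant: for g : D → D' conformal with boundary values a ↦ a', b ↦ b' and
any continuous
        Φ : ℂ → ℂ agreeing with g on D, P D' = Φ_* (P D);
 (restr) P has the (two-sided) restriction property: for Jordan D' ⊆ D with the same marked points,
        P D' (T) · P D (range ⊆ D̄') = P D (T ∩ {range ⊆ D̄'})  (P D' is P D conditioned to stay in
D̄');
 (simple) P D is carried by simple curves meeting ∂D only at a, b.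
Then Lawler–Schramm–Werner's chordal conformal-restriction theorem (arXiv:math/0209343, p.5 result 2
with Prop. 3.3
and Thm 6.1: the only restriction measure carried by simple curves is P_{5/8} = chordal SLE_{8/3})
identifies P D as
the SLE_{8/3} law, and (lim) becomes Literature.Probability.RandomPlanarGeometry.ConvergesInLawToSLE
(8/3), i.e. SAWScalingLimit.

Lean (X1, elaborates with imports Literature.Probability.RandomPlanarGeometry.ChordalCurveFamily):
∃ P : Literature.Probability.RandomPlanarGeometry.ChordalFamily, P.IsChordal ∧ (∀ (D :
Literature.Probability.RandomPlanarGeometry.DobrushinDomain) (a b : ℝ →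
Literature.Probability.LatticeModels.Site 2),
Literature.Probability.RandomPlanarGeometry.SAW.IsEndpointApprox D a b →
Literature.Probability.RandomPlanarGeometry.TendstoLaw (fun δ (γ :
Literature.Probability.RandomPlanarGeometry.SAW.DomainSAW D.carrier δ (a δ) (b δ)) => γ.curve) (fun
δ => Literature.Probability.RandomPlanarGeometry.SAW.law D.carrier δ (a δ) (b δ)) id (P D)) ∧ (∀ (D
D' : Literature.Probability.RandomPlanarGeometry.DobrushinDomain) (g :
Literature.Probability.RandomPlanarGeometry.ConformalEquiv D.carrier D'.carrier) (Φ : C(ℂ, ℂ)),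
g.HasBoundaryValue (D.pt 0) (D'.pt 0) → g.HasBoundaryValue (D.pt 1) (D'.pt 1) → Set.EqOn Φ g
D.carrier → P D' = (P D).map (Literature.Probability.RandomPlanarGeometry.CurveClass.map Φ)) ∧ (∀ (D
D' : Literature.Probability.RandomPlanarGeometry.DobrushinDomain), D'.carrier ⊆ D.carrier → D'.pt 0
= D.pt 0 → D'.pt 1 = D.pt 1 → ∀ T : Set (Literature.Probability.RandomPlanarGeometry.CurveClass ℂ),
MeasurableSet T → P D' T * P D (Literature.Probability.RandomPlanarGeometry.CurveClass.rangeSubset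
(closure D'.carrier)) = P D (T ∩ Literature.Probability.RandomPlanarGeometry.CurveClass.rangeSubset
(closure D'.carrier))) ∧ (∀ D : Literature.Probability.RandomPlanarGeometry.DobrushinDomain, ∀ᵐ γ
∂(P D), γ ∈ Literature.Probability.RandomPlanarGeometry.CurveClass.simple ∧ γ.range ∩ frontier
D.carrier ⊆ {D.pt 0, D.pt 1})

Rationale: WHY THIS LINE. This is the Lawler–Schramm–Werner programme made crux-first. LSW04
(arXiv:math/0204277, p.3 and
Prediction 1 p.29): "if the scaling limit of SAW exists and is conformally covariant, then it is
SLE_{8/3}"; the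
mechanism is conformal restriction (LSW03 arXiv:math/0209343: restriction measures P_α exist iff α ≥
5/8, and the
only one on simple curves is P_{5/8} = chordal SLE_{8/3}). Since 2026-08-15 the characterisation is
a PROVED tree
theorem (Literature.Probability.RandomPlanarGeometry.LawlerSchrammWerner2003_holds); the deciding
theorem is
`closes : ConfCovLimit → RestrictionOfLimit → SimpleOfLimit → LSWCharacterisation →
SAWScalingLimit`, where the support
item LSWCharacterisation IS that fact by name
(Literature.Probability.RandomPlanarGeometry.LawlerSchrammWerner2003,
closable in one line from `_holds`) — carried as an item rather than inlined so that the route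
module imports only the
light statement file ConformalRestriction.lean (cone repair 2026-08-15: the proof file
ConformalRestrictionHolds.lean
drags 460 modules and ≤ 36 of the 38 flagged unproved named facts — SLE(κ,ρ), Brownian/SLE bubbles,
restriction-measure
existence, SLE8 trace, Itô formula — into the import cone, and SAWScalingLimitFamily.lean dragged
Percolation/CLE6 (2 more);
none of them is used by any item or by `closes`). At lattice level the restriction property of the
x_c^{|γ|}-weighted
SAW is an IDENTITY (LSW04 p.24), so the whole difficulty is concentrated in (i) precompactness /
existence of the limit,
(ii) its conformal covariance, (iii) two limit-passage estimates (restriction, simplicity). Area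
imported: conformal
restriction / Brownian intersection-exponent technology (LSW03 §3–§8, now in tree) and
weak-convergence machinery on the
curve space (Aizenman–Burchard tightness, Kemppainen–Smirnov arXiv:1212.6215 Thm 1.5; tree:
isTightMeasureSet_of_traversalBounds,
convergesInLawToSLE_of_isTightAlongMesh). No new objects posited.

RANKED CRUXES. r2 ConfCovLimit — ∃ P chordal with (lim) ∧ (conf): existence AND conformal covariance
of the SAW scaling
limit for all Dobrushin domains, endpoint-approximation independent (LSW04 p.3: both open). r3
EventualTight
(stmt-CriticalPhenomena-1881, shared with 12 sibling SAW routes) — for every (D, a_δ, b_δ) the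
pushed-forward critical
SAW laws are tight ALONG THE MESH FILTER
(Literature.Probability.RandomPlanarGeometry.IsTightAlongMesh: ∀ ε ∃ compact K,
eventually in δ → 0⁺ mass outside K ≤ ε). This is the REPAIRED form of the refuted r3 `Tight`
(IsTightLaws over all
δ ∈ (0,1], refuted 2026-08-13 by Theorems/SAWParafermionTightRefutation on far coincident endpoints
at δ ∈ (1/2,1] —
a quantifier artifact; the eventual form misses that witness and is exactly what the tree's
Prokhorov criterion
consumes). Precompactness half of r2; open (no annulus-crossing / Condition-G2 bound for x_c-SAW in
print; KS17 §4
omits SAW; sub-ballisticity DCH13 is the strongest input). r4 RestrictionOfLimit — any chordal P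
arising as the limit
(lim) satisfies (restr) for ALL Jordan D′ ⊆ D sharing a, b (portmanteau on the closed event range ⊆
D̄′; needs
P D(∂-touching of D′) = 0; typed WITHOUT LSW's "boundaries agree near a, b" proviso — refuter flag).
r5 SimpleOfLimit —
any such limit is carried by simple curves touching ∂D only at a, b. support EndpointRobust —
refutation guard on the
conjunct AS TYPED (all endpoint approximations). support LSWCharacterisation — the LSW03
characterisation by
name (= Literature.Probability.RandomPlanarGeometry.LawlerSchrammWerner2003; PROVED in tree,
one-line closure from
LawlerSchrammWerner2003_holds; an item only for import-cone hygiene). support AssemblyTarget — frame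
statement
LawlerSchrammWerner2003 → X1 → SAWScalingLimit (provable now with the route file's own light
imports: the term of
`closes`; candidate proof attached as evidence). assembly Assembly = LawlerSchrammWerner2003 →
ConfCovLimit →
RestrictionOfLimit → SimpleOfLimit → SAWScalingLimit (= closes with the fact as antecedent; provable
now, light).
Dropped 2026-08-15: Tight [refuted-misstated], LSWRestrictionFact stmt-0775 [its two SLE-fact
antecedents
exists_isSLECurve / IsSLECurve.map_eq are not needed; superseded here by the clean by-name
LSWCharacterisation].

KILL CRITERIA. ¬EventualTight (mass escaping to wild curves in some domain along δ → 0⁺) or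
¬EndpointRobust (an
approximation-dependent limit) refutes the conjunct SAWScalingLimit as typed, not just this route.
¬RestrictionOfLimit
on a pinched / tangential D′ (event {range ⊆ D̄′} with empty relative interior, so portmanteau
passes nothing) kills
r4 AS TYPED but is repairable by LSW's proviso (∂D′ = ∂D near a, b) — at the price of a variant of
LawlerSchrammWerner2003 with the weaker restriction hypothesis (the tree's statement takes
restriction for all D′). A
refutation of (conf) for a proven limit P (a lattice anisotropy surviving in the limit) kills this
route and every
sibling; the pivot would be an anisotropic-embedding statement, not the conjunct. The 2026-08-13
refutation of the
all-δ `Tight` was a typing artifact, not a kill.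

NOT DECOMPOSED YET. How to get (conf) (sibling routes SAWParafermion / SAWHexUniversality /
SAWStressTensor carry the
mechanisms); whether r2 should later be SPLIT as EventualTight + "uniqueness and covariance of
subsequential limits"
(tree: SAW.IsSubseqScalingLimitFamily, SAW.subseqLimitSet, TendstoLaw.unique) once EventualTight
moves; the
agree-near-a,b proviso for r4 together with the matching weaker-hypothesis LSW variant;
Carathéodory-vs-IsEndpointApprox
bookkeeping in r5. Sources: LawlerSchrammWerner2004SAW, arXiv:math/0209343, arXiv:1212.6215,
arXiv:1205.0401,
arXiv:1109.3091, DuminilCopinSmirnov2012, AizenmanBurchardDuke1999.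

CHEAPEST FALSIFIER. The portmanteau obstruction to r4 for a sub-domain D′ pinched at a (every curve
of {range ⊆ D̄′}
starts in closure(D ∖ D̄′)): a refuter can decide in one sitting whether RestrictionOfLimit as typed
is vacuous-or-false
there; next cheapest, ¬EndpointRobust on the unit disc with a radial-versus-tangential approach of
a_δ at depth ≫ δ
(Kennedy–Lawler boundary lattice effects, arXiv:1109.3091 p.11).

Novelty: NOVELTY (search-before-claim: `lit search --hybrid "self-avoiding walk scaling limit SLE 8/3
conformal restriction"` 12 local hits; `lit search … --source all` zbMATH/Crossref 21 merged
(OpenAlex/S2/arXiv rate-limited today); `lit frontier CriticalPhenomena --since 2018` 30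
descendants; `lit read` of arXiv:math/0204277 pp.3,5,14,17, arXiv:1206.2092 p.7, arXiv:0909.0203
pp.3,7, arXiv:2310.17299 pp.1-2).
Nearest prior art — the mechanism IS the Lawler–Schramm–Werner programme: LawlerSchrammWerner2004SAW
(arXiv:math/0204277: p.3 "if the scaling limit of SAW exists and is conformally covariant then [it]
is SLE_{8/3}", §3.4.5 lattice restriction identity, Prediction 1; held p.17 "we could have made
theorems of the type …") resting on the characterisation LawlerSchrammWerner2003Restriction
(arXiv:math/0209343, §1 result 2, Prop 3.3, Thm 6.1, Cor 8.6; in tree as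
Literature.Probability.RandomPlanarGeometry.LawlerSchrammWerner2003); restated as a conditional
theorem in BDGS2012 (arXiv:1206.2092 p.7) and in Alberts–Duminil-Copin (arXiv:0909.0203 p.3). The
only PROVED SAW → SLE_{8/3} statement is GwynneMiller2021SAW (arXiv:1608.00956, Thm 1.1: random
quadrangulations / √(8/3)-LQG, not δℤ²). Newest unconditional geometric input:
DuminilCopinHammond2013 (sub-ballisticity) and Krachun–Panagiotis arXiv:2310.17299 (quantitative,
hexagonal only).
Delta: none in mechanism — expected grade `known` (LSW programme made crux-first). What the route
adds is the bookkeeping the sources leave implicit  [refs: math/0204277, 1206.2092, 0909.0203, 2310.17299, math/0209343, 1608.00956, 1109.3091, LawlerSchrammWerner2003, BDGS2012, DuminilCopinHammond2013, KennedyLawler2013, KemppainenSmirnov2017, AizenmanBurchardDuke1999]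

Barriers (technique_class: conformal-restriction sle-cle precompactness symmetry-upgrade): technique_class: conformal-restriction sle-cle precompactness symmetry-upgrade
- Literature.Barriers.CriticalPhenomena.LiouvilleRigidity [planar-conformal-maps, riemann-mapping,
sle-cle]: does NOT apply — it blocks transplanting planar conformal-map / SLE technology to d = 3
(no Riemann mapping for n ≥ 3); this route is planar throughout (δℤ², Jordan domains, Carathéodory
boundary extension between Dobrushin domains, chordal SLE_{8/3}) and targets only the planar
conjunct SAWScalingLimit.
- Literature.Barriers.CriticalPhenomena.ScaleCovarianceNotMoebius [scale-implies-conformal,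
symmetry-upgrade]: its formal witness is a d = 3 correlation family (Euclidean + scale covariance ⇏
Möbius), but the moral bears on crux ConfCovLimit: the dihedral/translation symmetries of ℤ² plus
scale covariance of a putative limit do not yield the (conf) clause (covariance under all conformal
maps between Jordan domains, in particular under rotations of the lattice). The route does NOT evade
it — no upgrade mechanism is claimed; (conf) is deliberately left as the rank-2 crux and the
rationale defers its mechanism to model-specific input (sibling routes SAWParafermion /
SAWHexUniversality) or to a joint proof with (lim). Honest reading: "it does not; the bet is that
conformal covariance comes from elsewhere and this route only certifies that, once it does,
restriction + simplicity + LSW03 finish the identification".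
Catalogued barriers outside the token class that bear on individual cruxes:
- Liter

History (route lifecycle, newest last):
- 2026-08-14T13:39:52Z · BROKEN — Tight (stmt-CriticalPhenomena-0772, crux) refuted by Summit.CriticalPhenomena.SAWScalingLimit.Theorems.SAWParafermionTight_refuted (gate)
- 2026-08-15T16:17:38Z · rev 2: restated Assembly (stmt-CriticalPhenomena-0777), AssemblyTarget (stmt-CriticalPhenomena-0778) — repair: Tight (stmt-CriticalPhenomena-0772) refuted-MISSTATED by Summit.CriticalPhenomena.SAWScalingLimit.Theorems.SAWParafermionTight_refuted (IsTightLaws quan (planner-rrefute-CriticalPhenomena-SAWConfRestr-dc08dbd8-g4-0)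
- 2026-08-15T16:17:38Z · rev 2: dropped Tight, LSWRestrictionFact — repair: Tight (stmt-CriticalPhenomena-0772) refuted-MISSTATED by Summit.CriticalPhenomena.SAWScalingLimit.Theorems.SAWParafermionTight_refuted (IsTightLaws quan (planner-rrefute-CriticalPhenomena-SAWConfRestr-dc08dbd8-g4-0)
- 2026-08-15T16:17:39Z · REPAIRED (restate Assembly, AssemblyTarget; drop Tight, LSWRestrictionFact) — back to open: repair: Tight (stmt-CriticalPhenomena-0772) refuted-MISSTATED by Summit.CriticalPhenomena.SAWScalingLimit.Theorems.SAWParafermionTight_refuted (IsTightLaws quan (planner-rrefute-CriticalPhenomena-SAWConfRestr-dc08dbd8-g4-0)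
- 2026-08-15T16:19:44Z · rev 3: restated AssemblyTarget (stmt-CriticalPhenomena-8251) — post-repair hygiene: restate AssemblyTarget with the fully-qualified antecedent (the short form `Target → SAWScalingLimit` deduplicated onto stmt-CriticalPhenom (planner-rrefute-CriticalPhenomena-SAWConfRestr-dc08dbd8-g4-0)
- 2026-08-15T16:54:47Z · rev 5: restated Assembly (stmt-CriticalPhenomena-10514), AssemblyTarget (stmt-CriticalPhenomena-10627) — cone repair (rrepair-…-56e3005c, Phase-C guardrail): imports 4→3 (dropped ConformalRestrictionHolds [460-module closure, ≤ 36 of the 38 flagged unproved named f (planner-rrepair-CriticalPhenomena-SAWConfRestr-56e3005c-0)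

sub-problem: SAWScalingLimit · status: open · opened planner-plan-CriticalPhenomena-SAWScalingLimit-0 2026-08-13T19:09:33Z · rev 7 · ledger route-CriticalPhenomena-SAWConfRestriction
GENERATED by the gate from the ledger (D-0016/17). Provers cite these decls: `theorem foo : Summit.CriticalPhenomena.SAWScalingLimit.Theses.SAWConfRestriction.<Decl> := …` in Summits/CriticalPhenomena/SAWScalingLimit/Theorems/<Name>.lean.
-/

namespace Summit.CriticalPhenomena.SAWScalingLimit.Theses.SAWConfRestriction

open scoped BigOperators Topology Manifold Classical MeasureTheory ProbabilityTheory Matrix InnerProductSpace ComplexConjugate ContinuousMap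
open Filter Set Function TopologicalSpace MeasureTheory

attribute [summit_statement] _root_.SAWScalingLimit

/-- item stmt-CriticalPhenomena-0770 · target · rank 0 · open · by planner
why it might fail: Conjunction of r2,r4,r5 in strong form: all endpoint approximations, all Jordan sub-domains (no agree-near-a,b proviso), any continuous Φ in (conf). Dies if the ℤ² limit is approximation-dependent (boundary lattice effects) or not rotation/conformally covariant; (restr) exceeds LSW's framework.
sources: LawlerSchrammWerner2004SAW (arXiv:math/0204277) p.3, p.5, held p.14, p.17, LawlerSchrammWerner2003Restriction (arXiv:math/0209343) §1 result 2 (held p.2), Thm 6.1, Cor 8.6, KennedyLawler2013 (arXiv:1109.3091) p.11, DuminilCopinSmirnov2012 Conj. 1 (arXiv:1007.0575 p.7)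
[target] X1: there is a chordal curve family P on Dobrushin domains which (lim) is the weak limit of
the critical δZ^2 SAW laws Literature.Probability.RandomPlanarGeometry.SAW.law (pushed to CurveClass
C) for every domain and every endpoint approximation, (conf) is conformally covariant under
conformal maps respecting the two marked points, (restr) has the two-sided restriction property P D'
= P D conditioned on range ⊆ closure D' for Jordan D' ⊆ D with the same marked points, and (simple)
is carried by simple curves meeting ∂D only at a, b. LSW03 (arXiv:math/0209343 p.5 result 2) then
identifies P D as chordal SLE_{8/3}. -/
@[route_item "route-CriticalPhenomena-SAWConfRestriction"]
def Target : Prop :=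
  ∃ P : Literature.Probability.RandomPlanarGeometry.ChordalFamily, P.IsChordal ∧ (∀ (D : Literature.Probability.RandomPlanarGeometry.DobrushinDomain) (a b : ℝ → Literature.Probability.LatticeModels.Site 2), Literature.Probability.RandomPlanarGeometry.SAW.IsEndpointApprox D a b → Literature.Probability.RandomPlanarGeometry.TendstoLaw (fun δ (γ : Literature.Probability.RandomPlanarGeometry.SAW.DomainSAW D.carrier δ (a δ) (b δ)) => γ.curve) (fun δ => Literature.Probability.RandomPlanarGeometry.SAW.law D.carrier δ (a δ) (b δ)) id (P D)) ∧ (∀ (D D' : Literature.Probability.RandomPlanarGeometry.DobrushinDomain) (g : Literature.Probability.RandomPlanarGeometry.ConformalEquiv D.carrier D'.carrier) (Φ : C(ℂ, ℂ)), g.HasBoundaryValue (D.pt 0) (D'.pt 0) → g.HasBoundaryValue (D.pt 1) (D'.pt 1) → Set.EqOn Φ g D.carrier → P D' = (P D).map (Literature.Probability.RandomPlanarGeometry.CurveClass.map Φ)) ∧ (∀ (D D' : Literature.Probability.RandomPlanarGeometry.DobrushinDomain), D'.carrier ⊆ D.carrier → D'.pt 0 = D.pt 0 → D'.pt 1 =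 D.pt 1 → ∀ T : Set (Literature.Probability.RandomPlanarGeometry.CurveClass ℂ), MeasurableSet T → P D' T * P D (Literature.Probability.RandomPlanarGeometry.CurveClass.rangeSubset (closure D'.carrier)) = P D (T ∩ Literature.Probability.RandomPlanarGeometry.CurveClass.rangeSubset (closure D'.carrier))) ∧ (∀ D : Literature.Probability.RandomPlanarGeometry.DobrushinDomain, ∀ᵐ γ ∂(P D), γ ∈ Literature.Probability.RandomPlanarGeometry.CurveClass.simple ∧ γ.range ∩ frontier D.carrier ⊆ {D.pt 0, D.pt 1})

/-- item stmt-CriticalPhenomena-0771 · crux · rank 2 · open · by planner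
why it might fail: Open since LSW04 p.3 and typed STRONGER than any printed conjecture: (lim) for ALL IsEndpointApprox (a_δ may approach a from depth ≫δ; boundary lattice effects, Kennedy–Lawler) and (conf) includes rotations on ℤ², where no discrete-holomorphic handle exists (DCS observable is hexagonal-only).
sources: LawlerSchrammWerner2004SAW (arXiv:math/0204277) p.3, §3.4.2–3.4.3, Prediction 1 (held p.17), DuminilCopinSmirnov2012 Conj. 1 (arXiv:1007.0575 p.7: nearest-vertex endpoints only), KennedyLawler2013 (arXiv:1109.3091) p.11 'lattice effects that persist in the scaling limit', BDGS2012 (arXiv:1206.2092) p.7: existence + conformal invariance 'remains an open problem', Literature.Barriers.CriticalPhenomena.NienhuisWeightsExcludeVertexSAW (no exact vertex relation on ℤ²), GwynneMiller2021SAW (arXiv:1608.00956) Thm 1.1 — only proved SAW→SLE_{8/3} instance (LQG, not δℤ²)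
[crux] r2 (hardest): existence and conformal covariance of the SAW scaling limit — ∃ chordal family
P with (lim) the critical square-lattice SAW law in (Ω_δ; a_δ, b_δ) converges weakly to P D for
every Dobrushin domain and every endpoint approximation, and (conf) P D' = Φ_*(P D) for every
conformal g : D → D' with boundary values a↦a', b↦b' (Φ any continuous extension of g from D). LSW04
arXiv:math/0204277 p.3: both existence and conformal covariance are open; DuminilCopinSmirnov2012
Conj. 1. -/
@[route_item "route-CriticalPhenomena-SAWConfRestriction", crux]
def ConfCovLimit : Prop :=
  ∃ P : Literature.Probability.RandomPlanarGeometry.ChordalFamily, P.IsChordal ∧ (∀ (D : Literature.Probability.RandomPlanarGeometry.DobrushinDomain) (a b : ℝ → Literature.Probability.LatticeModels.Site 2), Literature.Probability.RandomPlanarGeometry.SAW.IsEndpointApprox D a b → Literature.Probability.RandomPlanarGeometry.TendstoLaw (fun δ (γ : Literature.Probability.RandomPlanarGeometry.SAW.DomainSAW D.carrier δ (a δ) (b δ)) => γ.curve) (fun δ => Literature.Probability.RandomPlanarGeometry.SAW.law D.carrier δ (a δ) (b δ)) id (P D)) ∧ (∀ (D D' : Literature.Probability.RandomPlanarGeometry.DobrushinDomain)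 (g : Literature.Probability.RandomPlanarGeometry.ConformalEquiv D.carrier D'.carrier) (Φ : C(ℂ, ℂ)), g.HasBoundaryValue (D.pt 0) (D'.pt 0) → g.HasBoundaryValue (D.pt 1) (D'.pt 1) → Set.EqOn Φ g D.carrier → P D' = (P D).map (Literature.Probability.RandomPlanarGeometry.CurveClass.map Φ))

/-- item stmt-CriticalPhenomena-1881 · crux · rank 3 · open · by planner
why it might fail: Open for x_c-SAW on Z^2: no annulus-crossing / KS Condition-G2 / RSW bound in print (KS17 §4 omits SAW; no FKG); sub-ballisticity (DCH13) and hexagonal-only decay (arXiv:2310.17299) are the strongest inputs; boundary approach under a general IsEndpointApprox is uncontrolled.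
sources: KemppainenSmirnov2017 (arXiv:1212.6215) Thm 1.5, Cor 1.7; §4 (G2 verified for FK/Ising/percolation/HE/LERW, not SAW), AizenmanBurchardDuke1999 Thms 1.1-1.2 (tree: Literature.Probability.RandomPlanarGeometry.isTightMeasureSet_of_traversalBounds, isTightAlongMesh_of_isTightMeasureSet_image), DuminilCopinHammond2013 (arXiv:1205.0401) Thm 1.1 (sub-ballistic SAW), arXiv:2310.17299 Thm 1 (quantitative sub-ballisticity, hexagonal lattice), LawlerSchrammWerner2004SAW (arXiv:math/0204277) §1 and §3.4.2 (existence of the limit open), Summit.CriticalPhenomena.SAWScalingLimit.Theorems.SAWParafermionTight_refuted (the all-δ form Tight is false; this eventual form misses its witness)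
[support] EVENTUAL TIGHTNESS of the critical SAW laws: for every Dobrushin domain and endpoint
approximation, IsTightAlongMesh (fun δ γ => γ.curve) (fun δ => SAW.law D δ a_δ b_δ) — for every ε
some compact set of CurveClass ℂ carries all but ε of the mass for all small δ. This is the form the
Prokhorov criterion convergesInLawToSLE_of_isTightAlongMesh consumes and the repair of the refuted
all-δ Tight (IsTightLaws over δ ∈ (0,1]) suggested by the refuting theorem; offered to routes
SAWParafermion / SAWConfRestriction as their restated r3/r4. -/
@[route_item "route-CriticalPhenomena-SAWConfRestriction", crux]
def EventualTight : Prop :=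
  ∀ (D : Literature.Probability.RandomPlanarGeometry.DobrushinDomain) (a b : ℝ → Literature.Probability.LatticeModels.Site 2), Literature.Probability.RandomPlanarGeometry.SAW.IsEndpointApprox D a b → Literature.Probability.RandomPlanarGeometry.IsTightAlongMesh (fun δ (γ : Literature.Probability.RandomPlanarGeometry.SAW.DomainSAW D.carrier δ (a δ) (b δ)) => γ.curve) (fun δ => Literature.Probability.RandomPlanarGeometry.SAW.law D.carrier δ (a δ) (b δ))

/-- item stmt-CriticalPhenomena-0773 · crux · rank 4 · open · by planner
why it might fail: Typed for ALL Jordan D'⊆D sharing a,b, no 'boundaries agree near a,b' proviso (LSW04 p.5; LSW03 hulls off 0): then every curve of {range⊆cl D'} starts in closure(D∖cl D'), the event has empty relative interior, portmanteau passes nothing; tangential D' has P D(range⊆cl D')>0. Beyond print.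
sources: LawlerSchrammWerner2004SAW (arXiv:math/0204277) p.5 ('∂D, ∂D′ agree near z, w'; 'smooth near z and w') and §3.4.5 held p.14 (lattice identity), LawlerSchrammWerner2003Restriction (arXiv:math/0209343) Def 3.1/Prop 3.3, Thm 6.1, Rem 3.8 ('boundary sufficiently nice near a and b'), Lawler2005 Prop 5.12 p.132 (excursion restriction for Jordan sub-domains) — continuum analogue, MeasureTheory.limsup_measure_closed_le_iff_liminf_measure_open_ge (Mathlib Portmanteau); Literature.Probability.RandomPlanarGeometry.CurveClass.isClosed_rangeSubset (CurveSpace.lean:504), refuter notes g28-1/g28-2/g28-3 on stmt-CriticalPhenomena-0773 (lattice bookkeeping: meshDomain largest component, vertices on ∂D′)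
[crux] r4: every chordal family P that is the weak limit (lim) of the critical SAW laws satisfies
the restriction property: for Jordan D' ⊆ D with the same marked points and measurable T, P D'(T) ·
P D(range ⊆ closure D') = P D(T ∩ {range ⊆ closure D'}). At lattice level this is an identity (LSW04
arXiv:math/0204277 p.24); the content is the passage to the limit (portmanteau on a closed event,
boundary-touching has P D-measure 0). -/
@[route_item "route-CriticalPhenomena-SAWConfRestriction", crux]
def RestrictionOfLimit : Prop :=
  ∀ P : Literature.Probability.RandomPlanarGeometry.ChordalFamily, P.IsChordal → (∀ (D : Literature.Probability.RandomPlanarGeometry.DobrushinDomain) (a b : ℝ → Literature.Probability.LatticeModels.Site 2), Literature.Probability.RandomPlanarGeometry.SAW.IsEndpointApprox D a b → Literature.Probability.RandomPlanarGeometry.TendstoLaw (fun δ (γ : Literature.Probability.RandomPlanarGeometry.SAW.DomainSAW D.carrier δ (a δ) (b δ)) => γ.curve) (fun δ => Literature.Probability.RandomPlanarGeometry.SAW.law D.carrier δ (a δ) (b δ)) id (P D)) → ∀ (D D' : Literature.Probability.RandomPlanarGeometry.DobrushinDomain), D'.carrier ⊆ D.carrier → D'.pt 0 = D.pt 0 →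 D'.pt 1 = D.pt 1 → ∀ T : Set (Literature.Probability.RandomPlanarGeometry.CurveClass ℂ), MeasurableSet T → P D' T * P D (Literature.Probability.RandomPlanarGeometry.CurveClass.rangeSubset (closure D'.carrier)) = P D (T ∩ Literature.Probability.RandomPlanarGeometry.CurveClass.rangeSubset (closure D'.carrier))

/-- item stmt-CriticalPhenomena-0774 · crux · rank 5 · open · by planner
why it might fail: Weak limits of simple polylines need not be simple (CurveClass.simple is not closed): needs uniform no-macroscopic-self-touching and no-boundary-crawling bounds for x_c-SAW under every endpoint approximation; only sub-ballisticity is in print, and LSW04 p.14 argues simplicity heuristically.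
sources: LawlerSchrammWerner2004SAW (arXiv:math/0204277) §3.4.5 held p.14 ('why the limit measure should lie on simple curves' — heuristic from restriction + mass continuity), KennedyLawler2013 (arXiv:1109.3091) p.11 boundary lattice effects (caution for the boundary clause under general IsEndpointApprox), DuminilCopinHammond2013 (arXiv:1205.0401) Thm 1.1; arXiv:2310.17299 Thm 1 (strongest unconditional geometric control, hexagonal), RohdeSchramm2005 / arXiv:math/0209343 held p.10 'SLE_{8/3} is a simple curve' — property of the candidate, circular for SAW limits, Literature.Probability.RandomPlanarGeometry.CurveClass.measurableSet_simple_holds (SimpleCurves.lean:647) — measurability now in tree; ∀ᵐ phrasing did not need it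
[crux] r5: every chordal weak limit P of the critical SAW laws is carried by simple curves that meet
∂D only at the marked points a, b (so that, transported to ℍ, K = range γ satisfies K ∩ ℝ = {0} as
in LSW03 §3). Expected (SLE_{8/3} is simple, κ ≤ 4) but a genuine estimate on the discrete walk (no
macroscopic near-self-touching, no boundary crawling; cf. Kennedy–Lawler arXiv:1109.3091). -/
@[route_item "route-CriticalPhenomena-SAWConfRestriction", crux]
def SimpleOfLimit : Prop :=
  ∀ P : Literature.Probability.RandomPlanarGeometry.ChordalFamily, P.IsChordal → (∀ (D : Literature.Probability.RandomPlanarGeometry.DobrushinDomain) (a b : ℝ → Literature.Probability.LatticeModels.Site 2), Literature.Probability.RandomPlanarGeometry.SAW.IsEndpointApprox D a b → Literature.Probability.RandomPlanarGeometry.TendstoLaw (fun δ (γ : Literature.Probability.RandomPlanarGeometry.SAW.DomainSAW D.carrier δ (a δ) (b δ)) => γ.curve) (fun δ => Literature.Probability.RandomPlanarGeometry.SAW.law D.carrier δ (a δ) (b δ)) id (P D)) → ∀ D : Literature.Probability.RandomPlanarGeometry.DobrushinDomain, ∀ᵐ γ ∂(P D), γ ∈ Literature.Probability.RandomPlanarGeometry.CurveClass.simple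 ∧ γ.range ∩ frontier D.carrier ⊆ {D.pt 0, D.pt 1}

/-- item stmt-CriticalPhenomena-0776 · support · rank 9 · open · by planner
[support] refutation guard on the conjunct as typed: for two endpoint approximations (a_δ,b_δ),
(a'_δ,b'_δ) of the same Dobrushin domain (both
Literature.Probability.RandomPlanarGeometry.SAW.IsEndpointApprox: joined in Ω_δ, mesh points → a, b,
no control on HOW they approach the boundary points), the difference of test integrals ∫ f∘curve d
law_δ tends to 0 as δ → 0+ for every bounded continuous f. Necessary for
Literature.Probability.RandomPlanarGeometry.SAW.SAWScalingLimit given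
Literature.Probability.RandomPlanarGeometry.IsSLECurve.map_eq; its negation (an
approximation-dependent limit, e.g. a_δ approaching a at distance ≫ δ from ∂Ω_δ) refutes the
conjunct. -/
@[route_item "route-CriticalPhenomena-SAWConfRestriction"]
def EndpointRobust : Prop :=
  ∀ (D : Literature.Probability.RandomPlanarGeometry.DobrushinDomain) (a b a' b' : ℝ → Literature.Probability.LatticeModels.Site 2), Literature.Probability.RandomPlanarGeometry.SAW.IsEndpointApprox D a b → Literature.Probability.RandomPlanarGeometry.SAW.IsEndpointApprox D a' b' → ∀ f : BoundedContinuousFunction (Literature.Probability.RandomPlanarGeometry.CurveClass ℂ) ℝ, Filter.Tendsto (fun δ => (∫ γ, f γ.curve ∂(Literature.Probability.RandomPlanarGeometry.SAW.law D.carrier δ (a δ) (b δ))) - ∫ γ, f γ.curve ∂(Literature.Probability.RandomPlanarGeometry.SAW.law D.carrier δ (a' δ) (b' δ))) (nhdsWithin 0 (Set.Ioi 0)) (nhds 0)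

-- earlier AssemblyTarget (stmt-CriticalPhenomena-0778, replaced 2026-08-15T16:17:38Z -> stmt-CriticalPhenomena-8251): retired by None — Literature.Probability.RandomPlanarGeometry.exists_isSLECurve → Literature.Probability.RandomPlanarGeometry.IsSLECurve.map_eq → LSWRestrictionFact → Target → SAWScalingLimit
-- earlier AssemblyTarget (stmt-CriticalPhenomena-10627, replaced 2026-08-15T16:54:47Z -> stmt-CriticalPhenomena-11213): retired by None — Summit.CriticalPhenomena.SAWScalingLimit.Theses.SAWConfRestriction.Target → SAWScalingLimit
-- earlier AssemblyTarget (stmt-CriticalPhenomena-8251, replaced 2026-08-15T16:19:44Z -> stmt-CriticalPhenomena-10627): proved by Summit.CriticalPhenomena.SAWScalingLimit.Theorems.DetDiagAssemblyTarget_proof @ 46c05c195dc9 — Target → SAWScalingLimit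
/-- item stmt-CriticalPhenomena-11213 · support · rank 9 · closed · proved by Summit.CriticalPhenomena.SAWScalingLimit.Theorems.ConfRestrictionAssemblyTarget_proof @ e5a785e488f1 (prover) · by planner
[support] frame statement #1 (fact → X1 → Statement): given the Lawler–Schramm–Werner
characterisation by name (the Literature fact LawlerSchrammWerner2003, = item LSWCharacterisation,
PROVED in tree), the target X1 of THIS route (a chordal family with (lim), (conf), (restr),
(simple); antecedent fully qualified so the signature cannot collide with another route's Target)
implies SAWScalingLimit: read the four clauses off X1, apply the fact to get IsSLELaw (8/3) D (P D)
for every D, then move the test integrals of (lim) along integral_map (SAW.aemeasurable_curve for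
the discrete side). Provable NOW with the route file's own light imports (candidate proof rc0 in the
planner's Sketch.lean, attached as evidence; do not import SAWScalingLimitFamily /
ConformalRestrictionHolds — import-cone hygiene). -/
@[route_item "route-CriticalPhenomena-SAWConfRestriction"]
def AssemblyTarget : Prop :=
  Literature.Probability.RandomPlanarGeometry.LawlerSchrammWerner2003 → Summit.CriticalPhenomena.SAWScalingLimit.Theses.SAWConfRestriction.Target → SAWScalingLimit

/-- item stmt-CriticalPhenomena-11214 · support · rank 9 · open · by planner
[support] The Lawler–Schramm–Werner chordal conformal-restriction characterisation BY NAME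
(Literature def `LawlerSchrammWerner2003`, ConformalRestriction.lean; arXiv:math/0209343 p.5 result
2 with Prop. 3.3, Thm 6.1, Cor. 8.6, transposed to chordal families on Dobrushin domains): a
chordal, conformally covariant family with two-sided restriction carried by simple curves meeting
the boundary only at the marked points is, in every domain, the chordal SLE_{8/3} law. PROVED in
tree (`Literature.Probability.RandomPlanarGeometry.LawlerSchrammWerner2003_holds`,
ConformalRestrictionHolds.lean, whitelisted axioms); one-line closure `theorem … :
LSWCharacterisation := Literature.Probability.RandomPlanarGeometry.LawlerSchrammWerner2003_holds`.
Carried as an explicit item (4th hypothesis of `closes`) instead of being inlined so that the route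
module imports the 13-module statement file and not the 460-module proof file, whose import cone
carries the remaining ≤ 36 of the 38 flagged unproved named facts (SLE(κ,ρ), Brownian/SLE bubbles,
restriction-measure existence, SLE_8 trace, Itô formula) — none used by this route — cone repair
2026-08-15. Supersedes the dropped LSWRestrictionFact (stmt-Cri -/
@[route_item "route-CriticalPhenomena-SAWConfRestriction", crux]
def LSWCharacterisation : Prop :=
  Literature.Probability.RandomPlanarGeometry.LawlerSchrammWerner2003

/-- item stmt-CriticalPhenomena-14138 · support · rank 9 · closed · proved by Summit.CriticalPhenomena.SAWScalingLimit.Theorems.ConfRestrictionTargetOfCruxes_proof @ e5a785e488f1 (prover) · by planner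
[support] glue from the three cruxes to the rank-0 target X1 (route-choice repair 2026-08-16, gate
shape route.target-unreachable, option (a) "add glue item(s) Crux… → Target"): ConfCovLimit (∃ P
chordal with (lim) ∧ (conf)), RestrictionOfLimit (every chordal weak limit of the critical SAW laws
has the two-sided restriction property (restr)) and SimpleOfLimit (every such limit is carried by
simple curves meeting ∂D only at a, b) imply Target (∃ P chordal with (lim) ∧ (conf) ∧ (restr) ∧
(simple)): take P from ConfCovLimit and apply the two ∀-cruxes to it. Pure logic, provable NOW with
the route file's own imports (planner Sketch.lean rc 0, axioms propext / Classical.choice /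
Quot.sound): `intro hcc hr hs; obtain ⟨P, hch, hlim, hconf⟩ := hcc; exact ⟨P, hch, hlim, hconf, hr P
hch hlim, hs P hch hlim⟩`. Together with AssemblyTarget (LSWCharacterisation → Target →
SAWScalingLimit; candidate proof also rc 0 in Sketch.lean) it realises the chain cruxes → Target →
Statement explicitly; it changes nothing in the certified deciding theorem `closes : ConfCovLimit →
RestrictionOfLimit → SimpleOfLimit → LSWCharacterisation → SAWScalingLimit` and carries no
mathematical risk. Antecedents are ful -/
@[route_item "route-CriticalPhenomena-SAWConfRestriction"]
def TargetOfCruxes : Prop :=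
  Summit.CriticalPhenomena.SAWScalingLimit.Theses.SAWConfRestriction.ConfCovLimit → Summit.CriticalPhenomena.SAWScalingLimit.Theses.SAWConfRestriction.RestrictionOfLimit → Summit.CriticalPhenomena.SAWScalingLimit.Theses.SAWConfRestriction.SimpleOfLimit → Summit.CriticalPhenomena.SAWScalingLimit.Theses.SAWConfRestriction.Target

-- earlier Assembly (stmt-CriticalPhenomena-0777, replaced 2026-08-15T16:17:38Z -> stmt-CriticalPhenomena-10514): retired by None — Literature.Probability.RandomPlanarGeometry.exists_isSLECurve → Literature.Probability.RandomPlanarGeometry.IsSLECurve.map_eq → LSWRestrictionFact → ConfCovLimit → RestrictionOfLimit → SimpleOfLimit → SAWScalingLimit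
-- earlier Assembly (stmt-CriticalPhenomena-10514, replaced 2026-08-15T16:54:47Z -> stmt-CriticalPhenomena-11212): retired by None — ConfCovLimit → RestrictionOfLimit → SimpleOfLimit → SAWScalingLimit
/-- item stmt-CriticalPhenomena-11212 · assembly · rank 1 · closed · proved by Summit.CriticalPhenomena.SAWScalingLimit.Theorems.ConfRestrictionAssembly_proof @ e4efeb6a8d7b (prover) · by planner
[assembly] LawlerSchrammWerner2003 → ConfCovLimit → RestrictionOfLimit → SimpleOfLimit →
SAWScalingLimit (cone repair 2026-08-15: the LSW characterisation enters as an antecedent — the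
Literature fact by name, = item LSWCharacterisation — so the assembly is provable with the route
file's own light imports; it is the term of the deciding theorem `closes`). Proof: take P from
ConfCovLimit; RestrictionOfLimit and SimpleOfLimit give (restr) and (simple); the antecedent gives
IsSLELaw (8/3) D (P D) for every D, i.e. P D = W.map Γ for a chordal SLE_{8/3} curve Γ; moving the
test integrals of (lim) along integral_map (measurability of γ ↦ γ.curve is SAW.aemeasurable_curve)
yields ConvergesInLawToSLE (8/3), i.e. SAWScalingLimit. Candidate proof rc0 in the planner's
Sketch.lean (attached as evidence); provers: do NOT import SAWScalingLimitFamily /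
ConformalRestrictionHolds for it (import-cone hygiene) — the route file's imports suffice. -/
@[route_item "route-CriticalPhenomena-SAWConfRestriction"]
def Assembly : Prop :=
  Literature.Probability.RandomPlanarGeometry.LawlerSchrammWerner2003 → ConfCovLimit → RestrictionOfLimit → SimpleOfLimit → SAWScalingLimit

-- records of items no longer active in this route (dropped / restated):
-- earlier Tight (stmt-CriticalPhenomena-0772, dropped 2026-08-15T16:17:38Z): refuted by Summit.CriticalPhenomena.SAWScalingLimit.Theorems.SAWParafermionTight_refuted — ∀ (D : Literature.Probability.RandomPlanarGeometry.DobrushinDomain) (a b : ℝ → Literature.Probability.LatticeModels.Site 2), Literature.Probability.RandomPlanarGeometry.SAW.IsEndpointApprox D a b → Literature.Probability.RandomPlanarG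

/-! D-0027 §2.1 — DECIDING THEOREM (planner-authored via `route open/edit --closes-file`; by planner-rchoice-CriticalPhenomena-SAWConfRestr-e650032a-0 2026-08-16T03:24:23Z):
its hypotheses are this route's items and its conclusion the sub-problem Statement (glue_lint), and it elaborates with this file. -/

-- D-0027 §2.1 deciding theorem of route SAWConfRestriction (cone repair 2026-08-15, rev 4).
-- From the conformally covariant scaling limit (`ConfCovLimit`), restriction of the limit
-- (`RestrictionOfLimit`), simplicity of the limit (`SimpleOfLimit`) and the Lawler–Schramm–Werner
-- chordal restriction characterisation carried BY NAME as the support item `LSWCharacterisation`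
-- (`:= Literature.Probability.RandomPlanarGeometry.LawlerSchrammWerner2003`, PROVED in tree as
-- `LawlerSchrammWerner2003_holds` in `ConformalRestrictionHolds.lean`; kept as an item so that this
-- route module imports only the light statement file `ConformalRestriction.lean`), every `P D` is
-- the chordal SLE_{8/3} law; the weak limit (lim) then becomes `ConvergesInLawToSLE (8/3)` by moving
-- the test integrals along `integral_map` (the two-line argument of
-- `SAW.IsScalingLimitFamily.sawScalingLimit`, inlined to avoid importing `SAWScalingLimitFamily`
-- and, through it, `Percolation/CLE6`).
@[closes "route-CriticalPhenomena-SAWConfRestriction"] theorem closes (h_ConfCovLimit : ConfCovLimit) (h_RestrictionOfLimit : RestrictionOfLimit)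
    (h_SimpleOfLimit : SimpleOfLimit) (h_LSWCharacterisation : LSWCharacterisation) :
    _root_.SAWScalingLimit := by
  obtain ⟨P, hch, hlim, hconf⟩ := h_ConfCovLimit
  have hrestr := h_RestrictionOfLimit P hch hlim
  have hsimple := h_SimpleOfLimit P hch hlim
  have hsle : ∀ D : Literature.Probability.RandomPlanarGeometry.DobrushinDomain,
      Literature.Probability.RandomPlanarGeometry.IsSLELaw ((8 : NNReal) / 3) D (P D) :=
    h_LSWCharacterisation P hch hconf hrestr hsimple
  intro D a b hab
  obtain ⟨Γ, hΓ, hPD⟩ := hsle D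
  refine ⟨Γ, hΓ, Filter.Eventually.of_forall fun δ =>
    Literature.Probability.RandomPlanarGeometry.SAW.aemeasurable_curve _ _ _ _, fun f => ?_⟩
  have h := hlim D a b hab f
  simp only [id_eq, hPD] at h
  rwa [MeasureTheory.integral_map hΓ.aemeasurable f.continuous.aestronglyMeasurable] at h

end Summit.CriticalPhenomena.SAWScalingLimit.Theses.SAWConfRestriction
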